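import Mathlib
import HarnessLib

/-!
# Alive2's refinement of values and of final states (integer / floating-point fragment)

Source followed verbatim: N. P. Lopes, J. Lee, C.-K. Hur, Z. Liu, J. Regehr, *Alive2: Bounded Translation
Validation for LLVM*, PLDI 2021 [LopesEtAl2021], Figure 2 (values), Figure 4 and §5.1 (refinement of value and
final state), §5 (correctness = refinement, "the target function displays a subset of the behaviors of a source
function").

Printed definitions (Fig. 2): `Value ::= P(DefinedValue) ⊎ {poison} ⊎ Aggregate`, "A value is either poison or a
set of integer/floating-point numbers or pointers. The set of values is not a singleton if the value is undef.
When a value is used, one of the elements of the set is picked non-deterministically." (§3).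
Printed rules (Fig. 4): `element-nonptr: ν ∈ Int ⊎ Float ⟹ ν ⊒e ν`; `value-poison: poison ⊒ v`;
`value-undef: v, v' ∈ P(DefinedValue), (∀ν'∈v'. ∃ν∈v. ν ⊒e ν') ⟹ v ⊒ v'`;
`final-state-ub: ⟨r, M, true⟩ ⊒st ⟨r', M', ub'⟩`; `final-state: r ⊒ r', M ⊒m M' ⟹ ⟨r, M, false⟩ ⊒st ⟨r', M', false⟩`.
§5.1: "A value v is refined by another value v′, or v ⊒ v′, if v′ is equivalent to or more defined than v. […]
poison is refined by any value (value-poison). […] A (partially) undef value is refined by another undef value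
that is equally or more defined (value-undef). […] A final state s is refined by s′ […] if (1) s is undefined
(final-state-ub), or (2) refinement between their respective return values and memories holds (final-state)."

## What is formalised (special case) and what is not
We transcribe the NON-POINTER, NON-AGGREGATE fragment: defined values of an arbitrary type `α` (bit-vectors
`BitVec n`, IEEE floats, …) where element refinement `⊒e` is EQUALITY (rule element-nonptr), so that
value-undef reads `v' ⊆ v`; and final states WITHOUT the memory component (`⟨r, ub⟩`). Pointers (rule
element-ptr), aggregates (value-aggregate), `noreturn` (value-noreturn) and memory refinement `⊒m` (Lee et al.,
CAV 2021) are NOT here. -- TODO(general form): add `Aggregate`, pointers and the memory component.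
This fragment is exactly what a pure InstCombine/InstSimplify integer rewrite needs; it is strictly finer than
the `Option (BitVec w)` model of lean-mlir (Böving et al., OOPSLA 2025), which merges `undef` into either
`poison` or a chosen value — `Val.ofOption` below records that comparison map.

Proved API: `Refines` is reflexive and transitive (refinement composes across passes, §5 "compositionality"),
`poison` is the top, a well-defined singleton is refined only by itself among well-defined values, `undef`
(the full set) is refined by every non-poison value, and final-state refinement unfolds as printed.

Second part (appended): the VALUE-SET SEMANTICS of the sample instructions of Figure 3 (`add`/`add-poison` as
the generic elementwise rule `Val.map₂`, `add nuw`, the UB condition of `udiv`, `freeze` with its pick as an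
explicit non-determinism variable), monotonicity of instructions for `⊒` (compositionality), the two displayed
NON-DETERMINISTIC correctness criteria of §5.2 (`TransformationCorrectND₀`, and the "final version that Alive2
actually uses" `TransformationCorrectND`) with the printed reason for the change and the reduction to §5.1 for
deterministic functions, and the §2 worked example as theorems: `add %a, %a ⟶ mul %a, 2` is a refinement for
every `%a`, the converse is not one at `%a = undef` ("the result of the addition could be odd") but is one
when `%a` is not undef, and after `freeze` both directions are §5.2-correct ("%b will always be an even
number").
-/

namespace Literature.Computability.LopesEtAl2021

universe u

/-- Alive2 values over a type `α` of defined values (Fig. 2: `Value ::= P(DefinedValue) ⊎ {poison}`, aggregates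
omitted): either `poison`, or a set of defined values ("The set of values is not a singleton if the value is
undef", §3). A well-defined value is `vals {a}`; a fully `undef` value is `vals Set.univ`.
[cite: LopesEtAl2021, Figure 2 and §3] -/
inductive Val (α : Type u) : Type u
  | poison : Val α
  | vals (s : Set α) : Val α

namespace Val

variable {α : Type u}

/-- The well-defined value `a` (a singleton set, §3). [cite: LopesEtAl2021, §3] -/
def defined (a : α) : Val α := vals {a}

/-- The fully undefined value `undef` of the type: "they represent any value of their type" (§2); Alive2 itself
only distinguishes fully-undef inputs (§3.2 "we only allow an argument to be either fully undef or not undef at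
all"). [cite: LopesEtAl2021, §2 and §3.2] -/
def undef : Val α := vals Set.univ

/-- **Refinement of values** `v ⊒ v'` ("`v` is refined by `v'`", source `v`, target `v'`), Fig. 4 restricted to
non-pointer defined values where `⊒e` is equality: `poison ⊒ v` for every `v` (value-poison); `vals s ⊒ vals s'`
iff `∀ ν' ∈ s', ∃ ν ∈ s, ν = ν'`, i.e. `s' ⊆ s` (value-undef with element-nonptr); a set of defined values is
never refined by `poison`. [cite: LopesEtAl2021, Figure 4 and §5.1] -/
def Refines : Val α → Val α → Prop
  | poison, _ => True
  | vals _, poison => False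
  | vals s, vals s' => s' ⊆ s

/-- value-poison: `poison` is refined by any value. [cite: LopesEtAl2021, Figure 4 (value-poison)] -/
@[simp] theorem poison_refines (v : Val α) : Refines poison v := trivial

/-- A set of defined values is not refined by `poison` ("the target … is poison only when the source's … is
poison", §5.3 item 4). [cite: LopesEtAl2021, §5.3] -/
@[simp] theorem not_vals_refines_poison (s : Set α) : ¬ Refines (vals s) poison := fun h => h

/-- value-undef with element-nonptr: `vals s ⊒ vals s' ↔ s' ⊆ s` (the target may only REMOVE
non-determinism, §5). [cite: LopesEtAl2021, Figure 4 (value-undef, element-nonptr)] -/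
@[simp] theorem vals_refines_vals_iff (s s' : Set α) : Refines (vals s) (vals s') ↔ s' ⊆ s := Iff.rfl

/-- Two well-defined values: refinement "degenerates to simple equivalence" (§1).
[cite: LopesEtAl2021, §1 and Figure 4] -/
@[simp] theorem defined_refines_defined_iff (a b : α) : Refines (defined a) (defined b) ↔ a = b := by
  simp [defined, Refines, eq_comm]

/-- `undef` is refined by every set of defined values (any target choice resolves the non-determinism).
[cite: LopesEtAl2021, §5 ("the target function is allowed to remove non-determinism")] -/
@[simp] theorem undef_refines_vals (s : Set α) : Refines (undef : Val α) (vals s) := Set.subset_univ s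

/-- Refinement is reflexive. [cite: LopesEtAl2021, §5.1] -/
theorem refines_refl (v : Val α) : Refines v v := by
  cases v <;> simp [Refines]

/-- Refinement is transitive (so per-pass refinement composes along a pipeline; §5 "compositionality").
[cite: LopesEtAl2021, §5] -/
theorem refines_trans {v₁ v₂ v₃ : Val α} (h₁₂ : Refines v₁ v₂) (h₂₃ : Refines v₂ v₃) : Refines v₁ v₃ := by
  cases v₁ <;> cases v₂ <;> cases v₃ <;> simp_all [Refines]
  exact Set.Subset.trans h₂₃ h₁₂

/-- `Refines` as a preorder on `Val α`. [cite: LopesEtAl2021, §5.1] -/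
instance : IsPreorder (Val α) Refines where
  refl := refines_refl
  trans _ _ _ := refines_trans

/-- The comparison map from the coarser `Option`-model used by lean-mlir / `bv_decide` evaluations (Böving et
al. 2025: LLVM values as `Option (BitVec w)`, `none` = poison): `none ↦ poison`, `some a ↦ defined a`. It is
injective but not surjective (no image is a non-singleton `vals s`, i.e. `undef` is not representable), which is
the precise sense in which that model is "less precise than Alive … with respect to … undefined behaviour and
poison". [cite: LopesEtAl2021, §2 (undef vs poison)] -/
def ofOption : Option α → Val α
  | none => poison
  | some a => defined a

/-- On the image of `ofOption`, Alive2 refinement is the usual "poison-or-equal" order of the `Option` model.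
[cite: LopesEtAl2021, Figure 4] -/
theorem ofOption_refines_ofOption_iff (x y : Option α) :
    Refines (ofOption x) (ofOption y) ↔ x = none ∨ x = y := by
  cases x <;> cases y <;> simp [ofOption, Refines, defined, eq_comm]

end Val

/-- Final states WITHOUT the memory component: return value and the UB flag (Fig. 2: `FinalState ::=
ValueNoRet × Memory × bool`; `noreturn` and `Memory` omitted here). [cite: LopesEtAl2021, Figure 2] -/
structure FinalState (α : Type u) : Type u where
  /-- the returned value -/
  ret : Val α
  /-- "a Boolean flag indicating whether the function triggered UB before returning" (§5.1) -/
  ub : Bool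

namespace FinalState

variable {α : Type u}

open Val

/-- **Refinement of final states** `s ⊒st s'` (Fig. 4, memory omitted): if the source triggered UB it is refined
by anything (final-state-ub); otherwise the target must not trigger UB and its return value must refine
(final-state). [cite: LopesEtAl2021, Figure 4 (final-state-ub, final-state) and §5.1] -/
def Refines (s s' : FinalState α) : Prop :=
  s.ub = true ∨ (s'.ub = false ∧ Val.Refines s.ret s'.ret)

/-- final-state-ub: an undefined source state is refined by every target state ("refinement always picks the
worst-case execution", CAV'21 §5.1). [cite: LopesEtAl2021, Figure 4 (final-state-ub)] -/
@[simp] theorem refines_of_ub (r : Val α) (s' : FinalState α) : FinalState.Refines (⟨r, true⟩ : FinalState α) s' :=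
  Or.inl rfl

/-- final-state: between UB-free states, refinement is refinement of the return values; and a UB-free source is
never refined by a UB target ("The target triggers UB only when the source does", §5.3 item 2).
[cite: LopesEtAl2021, Figure 4 (final-state) and §5.3] -/
@[simp] theorem refines_noUB_iff (r : Val α) (s' : FinalState α) :
    FinalState.Refines (⟨r, false⟩ : FinalState α) s' ↔ s'.ub = false ∧ Val.Refines r s'.ret := by
  simp [FinalState.Refines]

/-- Final-state refinement is reflexive. [cite: LopesEtAl2021, §5.1] -/
theorem refines_refl (s : FinalState α) : FinalState.Refines s s := by
  rcases s with ⟨r, _ | _⟩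
  · exact Or.inr ⟨rfl, Val.refines_refl r⟩
  · exact Or.inl rfl

/-- Final-state refinement is transitive. [cite: LopesEtAl2021, §5] -/
theorem refines_trans {s₁ s₂ s₃ : FinalState α} (h₁₂ : FinalState.Refines s₁ s₂) (h₂₃ : FinalState.Refines s₂ s₃) :
    FinalState.Refines s₁ s₃ := by
  rcases h₁₂ with h | ⟨h2ub, h12⟩
  · exact Or.inl h
  · rcases h₂₃ with h | ⟨h3ub, h23⟩
    · rw [h2ub] at h; exact absurd h (by decide)
    · exact Or.inr ⟨h3ub, Val.refines_trans h12 h23⟩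

end FinalState

/-- **Correctness of a transformation = refinement for every input (deterministic, memory-free case, §5.1)**:
for functions from inputs to final states, the target refines the source iff for all inputs related by input
refinement the final states are related by `⊒st`: "∀ I_src, I_tgt . I_src ⊒ I_tgt ∧ valid(I_src, I_tgt) ⟹
⟦f_src⟧(I_src) ⊒st ⟦f_tgt⟧(I_tgt)". Here inputs are tuples of `Val`s indexed by `ι`, input refinement is
componentwise, and the global precondition `valid` is a parameter. The non-deterministic version (§5.2, with
`∃ N_src`) is `TransformationCorrectND` below. [cite: LopesEtAl2021, §5.1] -/
def TransformationCorrect {ι : Type u} {α : Type u} (valid : (ι → Val α) → (ι → Val α) → Prop)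
    (fsrc ftgt : (ι → Val α) → FinalState α) : Prop :=
  ∀ Isrc Itgt : ι → Val α, (∀ i, Val.Refines (Isrc i) (Itgt i)) → valid Isrc Itgt →
    FinalState.Refines (fsrc Isrc) (ftgt Itgt)

/-- Sanity check of the printed reading "In the absence of undefined behaviors, refinement degenerates to
simple equivalence" (§1): for UB-free, poison-free, well-defined source and target outputs, `⊒st` is equality
of the returned values. [cite: LopesEtAl2021, §1] -/
theorem finalState_refines_defined_iff {α : Type u} (a b : α) :
    FinalState.Refines ⟨Val.defined a, false⟩ ⟨Val.defined b, false⟩ ↔ a = b := by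
  simp [FinalState.Refines]

/-! ## Figure 3: value-set semantics of selected instructions

Printed rules (Fig. 3, "Semantics of selected instructions"; `R` is the register file, `⟦op⟧R` the value of an
operand, `⟨R, M, b⟩` the state): `add-poison: ⟦op₁⟧R = poison ∨ ⟦op₂⟧R = poison ⟹ ⟨R[r ↦ poison], M, b⟩`;
`add: ⟦op₁⟧R = v₁, ⟦op₂⟧R = v₂, v₁, v₂ ∈ P(Int), v' = {(i₁ + i₂) mod 2^sz | i₁ ∈ v₁ ∧ i₂ ∈ v₂} ⟹ ⟨R[r ↦ v'], M, b⟩`;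
`add-nuw-overflow: ⟦op₁⟧R = v₁, ⟦op₂⟧R = v₂, v₁, v₂ ∈ P(Int), ∃ i₁ ∈ v₁, i₂ ∈ v₂ . i₁ + i₂ ≥ 2^sz ⟹ ⟨R[r ↦ poison], M, b⟩`;
`udiv-ub: ⟦op₂⟧R = v₂, v₂ = poison ∨ 0 ∈ v₂ ⟹ ⟨R, M, true⟩`;
`udiv-poison: ⟦op₁⟧R = poison, ⟦op₂⟧R = v₂, v₂ ∈ P(Int) ∧ 0 ∉ v₂ ⟹ ⟨R[r ↦ poison], M, b⟩`;
`freeze-poison: ⟦op⟧R = poison, v ∈ Num(sz) ⟹ ⟨R[r ↦ {v}], M, b⟩`;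
`freeze-pick: ⟦op⟧R = v, v ∈ P(DefinedValue), v' ∈ v ⟹ ⟨R[r ↦ {v'}], M, b⟩`.
"When a value is used, one of the elements of the set is picked non-deterministically" (§3): a binary operator
acts on value SETS over all pairs of independent picks (the two uses of `%a` in `add %a, %a` are independent,
§2). We transcribe the rules at register level — the value written to `r`; the unchanged components `M`, `b`
are dropped and `udiv-ub`'s `b := true` becomes the predicate `Val.udivUB`. For `α = BitVec sz`, `+` and `*`
ARE the operations modulo `2^sz` of the printed rules.
-/

namespace Val

variable {α β γ : Type u}

/-- The common shape of the binary-operator rules of Fig. 3 (`add-poison` + `add`): poison if either operand is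
poison, otherwise the set of all results over independent picks of the two operands,
`{f i₁ i₂ | i₁ ∈ v₁ ∧ i₂ ∈ v₂}`. [cite: LopesEtAl2021, Figure 3 (add-poison, add)] -/
def map₂ (f : α → β → γ) : Val α → Val β → Val γ
  | poison, _ => poison
  | vals _, poison => poison
  | vals s, vals t => vals (Set.image2 f s t)

/-- add-poison (left operand). [cite: LopesEtAl2021, Figure 3 (add-poison)] -/
@[simp] theorem map₂_poison_left (f : α → β → γ) (v : Val β) : map₂ f poison v = poison := rfl

/-- add-poison (right operand). [cite: LopesEtAl2021, Figure 3 (add-poison)] -/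
@[simp] theorem map₂_poison_right (f : α → β → γ) (v : Val α) : map₂ f v poison = poison := by
  cases v <;> rfl

/-- Rule `add` on value sets: all results over independent picks. [cite: LopesEtAl2021, Figure 3 (add)] -/
@[simp] theorem map₂_vals_vals (f : α → β → γ) (s : Set α) (t : Set β) :
    map₂ f (vals s) (vals t) = vals (Set.image2 f s t) := rfl

/-- On well-defined operands the rule is the ordinary operation. [cite: LopesEtAl2021, Figure 3 (add)] -/
@[simp] theorem map₂_defined_defined (f : α → β → γ) (a : α) (b : β) :
    map₂ f (defined a) (defined b) = defined (f a b) := by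
  simp [defined]

/-- Instructions are MONOTONE for refinement: refining the operands refines the result. This is the
compositionality the correctness criterion relies on ("The definition above ensures compositionality: if a
function's inputs are refined, so are the outputs", §5). [cite: LopesEtAl2021, Figure 3 and §5] -/
theorem map₂_mono (f : α → β → γ) {v₁ v₁' : Val α} {v₂ v₂' : Val β} (h₁ : Refines v₁ v₁')
    (h₂ : Refines v₂ v₂') : Refines (map₂ f v₁ v₂) (map₂ f v₁' v₂') := by
  cases v₁ with
  | poison => exact trivial
  | vals s =>
    cases v₁' with
    | poison => exact absurd h₁ (not_vals_refines_poison s)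
    | vals s' =>
      cases v₂ with
      | poison => simp
      | vals t =>
        cases v₂' with
        | poison => exact absurd h₂ (not_vals_refines_poison t)
        | vals t' => exact Set.image2_subset h₁ h₂

/-- Rule `add` (with `add-poison`): `v' = {(i₁ + i₂) mod 2^sz | i₁ ∈ v₁ ∧ i₂ ∈ v₂}`; over `BitVec sz`, `+` is
addition modulo `2^sz`. [cite: LopesEtAl2021, Figure 3 (add, add-poison)] -/
def add [Add α] : Val α → Val α → Val α := map₂ (· + ·)

/-- `mul` in the same value-set shape. Fig. 3 prints `add`, `add nuw`, `udiv` and `freeze` as its sample ("We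
give the semantics for a few example instructions"); §2 uses `mul %a, 2`: "multiplying %a by two (resulting in
an even number or poison)" — elementwise products, poison propagating. [cite: LopesEtAl2021, §2 and Figure 3] -/
def mul [Mul α] : Val α → Val α → Val α := map₂ (· * ·)

open Classical in
/-- Rules `add-nuw-overflow` + `add` + `add-poison` for `add nuw` on `isz`: the result is poison as soon as SOME
pair of picks overflows ("∃ i₁ ∈ v₁, i₂ ∈ v₂ . i₁ + i₂ ≥ 2^sz"), otherwise it is the value set of `add`.
[cite: LopesEtAl2021, Figure 3 (add-nuw-overflow, add, add-poison)] -/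
noncomputable def addNuw {sz : ℕ} : Val (BitVec sz) → Val (BitVec sz) → Val (BitVec sz)
  | poison, _ => poison
  | vals _, poison => poison
  | vals s, vals t =>
      if ∃ i₁ ∈ s, ∃ i₂ ∈ t, 2 ^ sz ≤ i₁.toNat + i₂.toNat then poison
      else vals (Set.image2 (· + ·) s t)

/-- On well-defined operands `add nuw` is poison iff the sum overflows, else the sum.
[cite: LopesEtAl2021, Figure 3 (add-nuw-overflow, add)] -/
theorem addNuw_defined_defined {sz : ℕ} (a b : BitVec sz) :
    addNuw (defined a) (defined b) =
      if 2 ^ sz ≤ a.toNat + b.toNat then poison else defined (a + b) := by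
  simp [addNuw, defined]

/-- Rule `udiv-ub`: "⟦op₂⟧R = v₂, v₂ = poison ∨ 0 ∈ v₂ ⟹ ⟨R, M, true⟩" — dividing by a value that MAY be zero
(poison, or any value set containing `0`) is immediate UB. [cite: LopesEtAl2021, Figure 3 (udiv-ub)] -/
def udivUB {sz : ℕ} : Val (BitVec sz) → Prop
  | poison => True
  | vals s => (0 : BitVec sz) ∈ s

/-- `udiv` by poison is UB. [cite: LopesEtAl2021, Figure 3 (udiv-ub)] -/
@[simp] theorem udivUB_poison {sz : ℕ} : udivUB (poison : Val (BitVec sz)) := trivial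

/-- `udiv` by `undef` is UB (one of the possible picks is `0`). [cite: LopesEtAl2021, Figure 3 (udiv-ub)] -/
theorem udivUB_undef {sz : ℕ} : udivUB (undef : Val (BitVec sz)) := Set.mem_univ _

/-- `udiv` by a well-defined value is UB iff that value is `0`. [cite: LopesEtAl2021, Figure 3 (udiv-ub)] -/
theorem udivUB_defined_iff {sz : ℕ} (a : BitVec sz) : udivUB (defined a) ↔ a = 0 := by
  change (0 : BitVec sz) ∈ ({a} : Set (BitVec sz)) ↔ a = 0
  rw [Set.mem_singleton_iff]
  exact eq_comm

/-- Rules `freeze-poison` / `freeze-pick`: "The result of freeze is a well-defined, arbitrarily chosen singleton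
value" (§2) — `R[r ↦ {v'}]` where the pick `v'` is any `v ∈ Num(sz)` if the operand is poison and an element
`v' ∈ v` of the operand's value set otherwise. The pick is the instruction's NON-DETERMINISM VARIABLE in the
sense of §5.2: it is the argument `n`, constrained by the precondition `FreezePre` (so that the same pick is
seen by every use of `r` — "an arbitrary, yet fixed value"). [cite: LopesEtAl2021, Figure 3 (freeze-poison,
freeze-pick) and §2] -/
def freeze (_v : Val α) (n : α) : Val α := defined n

/-- The constraint on the pick `n` of `freeze v`: none when `v` is poison (freeze-poison: `v ∈ Num(sz)`),
membership in the value set otherwise (freeze-pick: `v' ∈ v`). [cite: LopesEtAl2021, Figure 3 (freeze-poison,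
freeze-pick)] -/
def FreezePre : Val α → α → Prop
  | poison, _ => True
  | vals s, n => n ∈ s

/-- freeze-poison: any pick is allowed. [cite: LopesEtAl2021, Figure 3 (freeze-poison)] -/
@[simp] theorem freezePre_poison (n : α) : FreezePre (poison : Val α) n := trivial

/-- freeze-pick: the pick lies in the value set. [cite: LopesEtAl2021, Figure 3 (freeze-pick)] -/
@[simp] theorem freezePre_vals_iff (s : Set α) (n : α) : FreezePre (vals s) n ↔ n ∈ s := Iff.rfl

/-- Freezing `undef` may pick any value ("If %a is undef, %f will take an arbitrary, yet fixed value", §2).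
[cite: LopesEtAl2021, §2 and Figure 3 (freeze-pick)] -/
theorem freezePre_undef (n : α) : FreezePre (undef : Val α) n := Set.mem_univ n

/-- The result of `freeze` is the well-defined picked value. [cite: LopesEtAl2021, Figure 3 (freeze-pick)] -/
@[simp] theorem freeze_eq (v : Val α) (n : α) : freeze v n = defined n := rfl

/-- Picks only SHRINK along refinement: a pick allowed for a target operand is allowed for every source operand
it refines (this is how a source pick is found from the target's in §5.2). [cite: LopesEtAl2021, Figure 3
(freeze-pick) and Figure 4 (value-undef)] -/
theorem FreezePre.of_refines {v v' : Val α} (h : Refines v v') {n : α} (hn : FreezePre v' n) :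
    FreezePre v n := by
  cases v with
  | poison => exact trivial
  | vals s =>
    cases v' with
    | poison => exact absurd h (not_vals_refines_poison s)
    | vals s' => exact h hn

end Val

/-! ## §5.2 Nondeterministic execution

"The previous definition of correctness does not take non-determinism, such as undef values and freeze
instructions, into account. Let N_src and N_tgt be the set of variables used to encode non-determinism in
functions f_src and f_tgt, respectively. We extend the previous definition of refinement to support
non-determinism as follows:
  ∀ I_src, I_tgt, O_tgt . I_src ⊒ I_tgt ∧ valid(I_src, I_tgt) ∧ ∃ N_tgt . pre_tgt(I_tgt, N_tgt) ∧ ⟦f_tgt⟧(I_tgt, N_tgt) = O_tgt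
    ⟹ ∃ N_src . pre_src(I_src, N_src) ∧ ⟦f_src⟧(I_src, N_src) ⊒st O_tgt
Predicate pre represents the precondition of a function, which is used to constrain the non-determinism and the
inputs a function can take. […] Sometimes the precondition for the source function does not hold for a
particular input I_src for any non-determinism but it may hold for the target function. For example, LLVM is
allowed to remove the non-null attribute of a function's argument. The formula above fails in that case, since
then pre_src makes the right-hand side of the implication become false. To support such cases, we extend the
previous refinement condition to arrive at the final version that Alive2 actually uses:
  ∀ I_src, I_tgt, O_tgt . valid(I_src, I_tgt) ∧ ∃ N_src, N_tgt . pre_src(I_src, N_src) ∧ pre_tgt(I_tgt, N_tgt) ∧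
    ⟦f_tgt⟧(I_tgt, N_tgt) = O_tgt ⟹ ∃ N_src . pre_src(I_src, N_src) ∧ ⟦f_src⟧(I_src, N_src) ⊒st O_tgt"
(§5.2, verbatim up to notation). "In other words, for any fixed input I_src, if the target function produces a
given output O with some internal non-determinism N_tgt and refined input I_tgt (equal to or more defined than
I_src), the source function must produce the same output for some internal non-determinism N_src. Therefore,
the target function is allowed to remove non-determinism so it generates fewer outputs for a given input, but
not the other way around." (§5). Both displayed formulas are transcribed (memory-free final states as above;
the non-determinism variables range over parameter types `ν`, `ν'`); note that the final version as printed
carries the input relation inside `valid`.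
-/

/-- The FIRST displayed criterion of §5.2 (with the explicit conjunct `I_src ⊒ I_tgt`).
[cite: LopesEtAl2021, §5.2 (first display)] -/
def TransformationCorrectND₀ {ι α ν ν' : Type u} (valid : (ι → Val α) → (ι → Val α) → Prop)
    (preSrc : (ι → Val α) → ν → Prop) (preTgt : (ι → Val α) → ν' → Prop)
    (fsrc : (ι → Val α) → ν → FinalState α) (ftgt : (ι → Val α) → ν' → FinalState α) : Prop :=
  ∀ (Isrc Itgt : ι → Val α) (Otgt : FinalState α),
    (∀ i, Val.Refines (Isrc i) (Itgt i)) → valid Isrc Itgt →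
    (∃ Ntgt : ν', preTgt Itgt Ntgt ∧ ftgt Itgt Ntgt = Otgt) →
    ∃ Nsrc : ν, preSrc Isrc Nsrc ∧ FinalState.Refines (fsrc Isrc Nsrc) Otgt

/-- **Correctness of a transformation, non-deterministic case — "the final version that Alive2 actually uses"**
(§5.2, second display): for all input pairs allowed by `valid`, if the source precondition is satisfiable and
the target, under its precondition, produces the final state `O_tgt` for some choice of its non-determinism,
then the source produces, for some allowed choice of ITS non-determinism, a final state refined by `O_tgt`.
[cite: LopesEtAl2021, §5.2 (final version)] -/
def TransformationCorrectND {ι α ν ν' : Type u} (valid : (ι → Val α) → (ι → Val α) → Prop)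
    (preSrc : (ι → Val α) → ν → Prop) (preTgt : (ι → Val α) → ν' → Prop)
    (fsrc : (ι → Val α) → ν → FinalState α) (ftgt : (ι → Val α) → ν' → FinalState α) : Prop :=
  ∀ (Isrc Itgt : ι → Val α) (Otgt : FinalState α), valid Isrc Itgt →
    (∃ (Nsrc : ν) (Ntgt : ν'), preSrc Isrc Nsrc ∧ preTgt Itgt Ntgt ∧ ftgt Itgt Ntgt = Otgt) →
    ∃ Nsrc : ν, preSrc Isrc Nsrc ∧ FinalState.Refines (fsrc Isrc Nsrc) Otgt

section ND

variable {ι α ν ν' : Type u} {valid : (ι → Val α) → (ι → Val α) → Prop}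
  {preSrc : (ι → Val α) → ν → Prop} {preTgt : (ι → Val α) → ν' → Prop}
  {fsrc : (ι → Val α) → ν → FinalState α} {ftgt : (ι → Val α) → ν' → FinalState α}

/-- The final criterion with `O_tgt` eliminated: at every valid input pair where the source precondition is
satisfiable, every allowed target pick is matched by an allowed source pick whose final state it refines ("the
source function must produce the same output for some internal non-determinism N_src", §5).
[cite: LopesEtAl2021, §5 and §5.2] -/
theorem transformationCorrectND_iff :
    TransformationCorrectND valid preSrc preTgt fsrc ftgt ↔
      ∀ (Isrc Itgt : ι → Val α) (Ntgt : ν'), valid Isrc Itgt → (∃ Nsrc, preSrc Isrc Nsrc) →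
        preTgt Itgt Ntgt →
        ∃ Nsrc : ν, preSrc Isrc Nsrc ∧ FinalState.Refines (fsrc Isrc Nsrc) (ftgt Itgt Ntgt) := by
  constructor
  · rintro h Isrc Itgt Ntgt hv ⟨Ns, hNs⟩ hpt
    exact h Isrc Itgt _ hv ⟨Ns, Ntgt, hNs, hpt, rfl⟩
  · rintro h Isrc Itgt Otgt hv ⟨Ns, Nt, hNs, hpt, rfl⟩
    exact h Isrc Itgt Nt hv ⟨Ns, hNs⟩ hpt

/-- "Therefore, the target function is allowed to remove non-determinism so it generates fewer outputs for a
given input, but not the other way around": it suffices that every allowed target behaviour is refined by SOME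
allowed source behaviour, input pair by input pair. [cite: LopesEtAl2021, §5] -/
theorem TransformationCorrectND.of_forall_pick
    (h : ∀ (Isrc Itgt : ι → Val α) (Ntgt : ν'), valid Isrc Itgt → preTgt Itgt Ntgt →
      ∃ Nsrc : ν, preSrc Isrc Nsrc ∧ FinalState.Refines (fsrc Isrc Nsrc) (ftgt Itgt Ntgt)) :
    TransformationCorrectND valid preSrc preTgt fsrc ftgt :=
  transformationCorrectND_iff.2 fun Isrc Itgt Ntgt hv _ hpt => h Isrc Itgt Ntgt hv hpt

/-- The first displayed formula implies the final one (with the conjunct `I_src ⊒ I_tgt` carried by `valid`):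
the final version only weakens the requirement at inputs where `pre_src` is unsatisfiable.
[cite: LopesEtAl2021, §5.2] -/
theorem TransformationCorrectND₀.final (h : TransformationCorrectND₀ valid preSrc preTgt fsrc ftgt) :
    TransformationCorrectND (fun Is It => (∀ i, Val.Refines (Is i) (It i)) ∧ valid Is It)
      preSrc preTgt fsrc ftgt := by
  rintro Isrc Itgt Otgt ⟨hin, hv⟩ ⟨_, Nt, _, hpt, hO⟩
  exact h Isrc Itgt Otgt hin hv ⟨Nt, hpt, hO⟩

/-- The printed reason for the change: if for some valid input pair the source precondition fails for every
choice of non-determinism while the target precondition is satisfiable, the FIRST formula is false ("then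
pre_src makes the right-hand side of the implication become false") — whatever the two functions are.
[cite: LopesEtAl2021, §5.2] -/
theorem not_transformationCorrectND₀_of_preSrc_unsat
    (h : ∃ (Isrc Itgt : ι → Val α) (Ntgt : ν'), (∀ i, Val.Refines (Isrc i) (Itgt i)) ∧ valid Isrc Itgt ∧
      preTgt Itgt Ntgt ∧ ∀ Nsrc : ν, ¬ preSrc Isrc Nsrc) :
    ¬ TransformationCorrectND₀ valid preSrc preTgt fsrc ftgt := by
  intro hc
  obtain ⟨Is, It, Nt, hin, hv, hpt, hno⟩ := h
  obtain ⟨Ns, hNs, _⟩ := hc Is It _ hin hv ⟨Nt, hpt, rfl⟩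
  exact hno Ns hNs

/-- … while the FINAL formula is vacuously satisfied at such an input pair. [cite: LopesEtAl2021, §5.2] -/
theorem TransformationCorrectND.of_preSrc_unsat (h : ∀ (Isrc : ι → Val α) (Nsrc : ν), ¬ preSrc Isrc Nsrc) :
    TransformationCorrectND valid preSrc preTgt fsrc ftgt := by
  rintro Isrc _ _ _ ⟨Ns, _, hNs, _, _⟩
  exact absurd hNs (h Isrc Ns)

end ND

/-- Deterministic functions (no non-determinism variables, trivial preconditions): the §5.2 criterion IS the
§5.1 criterion `TransformationCorrect`. [cite: LopesEtAl2021, §5.1 and §5.2] -/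
theorem transformationCorrectND_punit_iff {ι α : Type u} (valid : (ι → Val α) → (ι → Val α) → Prop)
    (fsrc ftgt : (ι → Val α) → FinalState α) :
    TransformationCorrectND (fun Is It => (∀ i, Val.Refines (Is i) (It i)) ∧ valid Is It)
        (fun _ (_ : PUnit.{u+1}) => True) (fun _ (_ : PUnit.{u+1}) => True)
        (fun I _ => fsrc I) (fun I _ => ftgt I) ↔ TransformationCorrect valid fsrc ftgt := by
  constructor
  · intro h Isrc Itgt hin hv
    obtain ⟨_, _, hr⟩ := h Isrc Itgt (ftgt Itgt) ⟨hin, hv⟩ ⟨PUnit.unit, PUnit.unit, trivial, trivial, rfl⟩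
    exact hr
  · rintro h Isrc Itgt Otgt ⟨hin, hv⟩ ⟨_, _, _, _, rfl⟩
    exact ⟨PUnit.unit, trivial, h Isrc Itgt hin hv⟩

/-! ## §2: the `add %a, %a` example of Figure 1, and `freeze`

"The first line of the function adds the first argument %a to itself. This is not equivalent to multiplying %a
by two (resulting in an even number or poison) if %a is undef. Since undef may yield a different value each
time it is observed, the two references to %a in the add instruction may not resolve to the same value and
therefore the result of the addition could be odd." — "%f = freeze i32 %a; %b = add i32 %f, %f. If %a is
undef, %f will take an arbitrary, yet fixed value. Therefore, %b will always be an even number." (§2).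
Read through Fig. 3/Fig. 4 (each claim a theorem below, at every width `sz`, the counterexample for `sz ≥ 1`):
rewriting `add %a, %a` INTO `mul %a, 2` is a refinement for every value of `%a` (the target only removes
outcomes); the converse rewrite is NOT a refinement at `%a = undef`, and IS one when `%a` is not undef (poison
or well-defined — "In the absence of undefined behaviors, refinement degenerates to simple equivalence", §1);
after `freeze`, both directions satisfy the §5.2 criterion with the source pick := the target pick.
-/

namespace FigureOne

open Val

variable {sz : ℕ}

/-- In `BitVec sz`, `sz ≥ 1`, a doubled value is never `1` (it is even). [folklore] -/
private theorem add_self_ne_one (hsz : 0 < sz) (i : BitVec sz) : i + i ≠ 1 := by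
  intro h
  have h1 := congrArg (fun x : BitVec sz => x.toNat % 2) h
  have h2 : (1 : BitVec sz).toNat = 1 % 2 ^ sz := BitVec.toNat_ofNat 1 sz
  simp only [BitVec.toNat_add] at h1
  rw [Nat.mod_mod_of_dvd _ (dvd_pow_self 2 hsz.ne'), h2,
    Nat.mod_eq_of_lt (Nat.one_lt_two_pow hsz.ne')] at h1
  omega

/-- `add %a, %a` at `%a = undef` may return ANY value: the two uses are independent picks ("the result of the
addition could be odd"). [cite: LopesEtAl2021, §2 and Figure 3 (add)] -/
theorem add_undef_undef : add (undef : Val (BitVec sz)) undef = undef := by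
  simp only [add, undef, map₂_vals_vals]
  congr 1
  ext t
  simp only [Set.mem_univ, iff_true]
  exact ⟨t, trivial, 0, trivial, add_zero t⟩

/-- `mul %a, 2` at `%a = undef`: "an even number" (the doubles). [cite: LopesEtAl2021, §2] -/
theorem mul_undef_two :
    mul (undef : Val (BitVec sz)) (defined 2) = vals (Set.range fun i : BitVec sz => i + i) := by
  simp only [mul, undef, defined, map₂_vals_vals, Set.image2_singleton_right, Set.image_univ]
  exact congrArg (fun f : BitVec sz → BitVec sz => vals (Set.range f)) (funext fun i => mul_two i)

/-- `add %a, %a ⟶ mul %a, 2` is a refinement for EVERY value of `%a`: poison ↦ poison, and on value sets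
`{i·2 | i ∈ s} ⊆ {i₁ + i₂ | i₁, i₂ ∈ s}`. [cite: LopesEtAl2021, §2 and Figure 4 (value-undef)] -/
theorem refines_add_self_mul_two (a : Val (BitVec sz)) : Refines (add a a) (mul a (defined 2)) := by
  cases a with
  | poison => exact trivial
  | vals s =>
    change Set.image2 (· * ·) s {2} ⊆ Set.image2 (· + ·) s s
    rintro t ⟨i, hi, j, hj, rfl⟩
    rw [Set.mem_singleton_iff] at hj
    subst hj
    exact ⟨i, hi, i, hi, (mul_two i).symm⟩

/-- … but `mul %a, 2 ⟶ add %a, %a` is NOT a refinement at `%a = undef` (any width `sz ≥ 1`): the target may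
return the odd value `1`, which the source never returns. [cite: LopesEtAl2021, §2] -/
theorem not_refines_mul_two_add_self (hsz : 0 < sz) :
    ¬ Refines (mul (undef : Val (BitVec sz)) (defined 2)) (add undef undef) := by
  rw [add_undef_undef, mul_undef_two]
  intro h
  obtain ⟨i, hi⟩ := h (Set.mem_univ (1 : BitVec sz))
  exact add_self_ne_one hsz i hi

/-- The one-instruction function `%t = add %a, %a; ret %t` on the argument `%a` (no UB).
[cite: LopesEtAl2021, §2 (Figure 1, first line)] -/
def addSelfFn (I : Unit → Val (BitVec sz)) : FinalState (BitVec sz) := ⟨add (I ()) (I ()), false⟩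

/-- The one-instruction function `%t = mul %a, 2; ret %t` ("multiplying %a by two").
[cite: LopesEtAl2021, §2] -/
def mulTwoFn (I : Unit → Val (BitVec sz)) : FinalState (BitVec sz) := ⟨mul (I ()) (defined 2), false⟩

/-- `add %a, %a ⟹ mul %a, 2` is a correct transformation (§5.1 criterion, every input, no precondition).
[cite: LopesEtAl2021, §2 and §5.1] -/
theorem transformationCorrect_addSelf_mulTwo :
    TransformationCorrect (fun _ _ => True) (addSelfFn (sz := sz)) mulTwoFn := by
  intro Isrc Itgt hin _
  exact Or.inr ⟨rfl, refines_trans (map₂_mono _ (hin ()) (hin ())) (refines_add_self_mul_two (Itgt ()))⟩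

/-- `mul %a, 2 ⟹ add %a, %a` is NOT a correct transformation when `%a` may be undef (`sz ≥ 1`): "This is not
equivalent to multiplying %a by two … if %a is undef". [cite: LopesEtAl2021, §2 and §5.1] -/
theorem not_transformationCorrect_mulTwo_addSelf (hsz : 0 < sz) :
    ¬ TransformationCorrect (fun _ _ => True) (mulTwoFn (sz := sz)) addSelfFn := by
  intro h
  rcases h (fun _ => undef) (fun _ => undef) (fun _ => refines_refl _) trivial with h1 | ⟨_, h1⟩
  · exact Bool.false_ne_true h1
  · exact not_refines_mul_two_add_self hsz h1

/-- With `%a` known NOT to be undef (poison or a well-defined value — LLVM's `noundef`), `mul %a, 2 ⟹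
add %a, %a` IS correct: "In the absence of undefined behaviors, refinement degenerates to simple equivalence"
(§1). [cite: LopesEtAl2021, §1 and §2] -/
theorem transformationCorrect_mulTwo_addSelf_of_noundef :
    TransformationCorrect (fun Isrc _ => Isrc () = poison ∨ ∃ a, Isrc () = defined a)
      (mulTwoFn (sz := sz)) addSelfFn := by
  intro Isrc Itgt hin hv
  refine Or.inr ⟨rfl, ?_⟩
  change Refines (mul (Isrc ()) (defined 2)) (add (Itgt ()) (Itgt ()))
  have hin' := hin ()
  rcases hv with h | ⟨a, h⟩
  · rw [h]; exact trivial
  · rw [h] at hin' ⊢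
    cases hI : Itgt () with
    | poison => rw [hI] at hin'; exact absurd hin' (not_vals_refines_poison _)
    | vals s' =>
      rw [hI] at hin'
      change Set.image2 (· + ·) s' s' ⊆ Set.image2 (· * ·) {a} {2}
      rintro t ⟨i, hi, j, hj, rfl⟩
      have hi' : i = a := hin' hi
      have hj' : j = a := hin' hj
      rw [hi', hj']
      exact ⟨a, rfl, 2, rfl, mul_two a⟩

/-- `%f = freeze %a; %b = add %f, %f; ret %b`, the pick of `freeze` being the non-determinism variable `n`.
[cite: LopesEtAl2021, §2] -/
def freezeAddSelfFn (I : Unit → Val (BitVec sz)) (n : BitVec sz) : FinalState (BitVec sz) :=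
  ⟨add (freeze (I ()) n) (freeze (I ()) n), false⟩

/-- `%f = freeze %a; %b = mul %f, 2; ret %b`. [cite: LopesEtAl2021, §2] -/
def freezeMulTwoFn (I : Unit → Val (BitVec sz)) (n : BitVec sz) : FinalState (BitVec sz) :=
  ⟨mul (freeze (I ()) n) (defined 2), false⟩

/-- "If %a is undef, %f will take an arbitrary, yet fixed value. Therefore, %b will always be an even number."
[cite: LopesEtAl2021, §2] -/
theorem freezeAddSelfFn_ret (I : Unit → Val (BitVec sz)) (n : BitVec sz) :
    (freezeAddSelfFn I n).ret = defined (n + n) := by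
  simp [freezeAddSelfFn, add]

/-- After `freeze`, `add %f, %f ⟺ mul %f, 2` is correct in BOTH directions under the §5.2 criterion (input
refinement as `valid`, the freeze constraints as `pre`; the source pick is the target pick, allowed because
picks shrink along refinement) — contrast `not_transformationCorrect_mulTwo_addSelf`.
[cite: LopesEtAl2021, §2 and §5.2] -/
theorem transformationCorrectND_freeze_addSelf_mulTwo :
    TransformationCorrectND (fun Is It => ∀ i, Refines (Is i) (It i))
        (fun I n => FreezePre (I ()) n) (fun I n => FreezePre (I ()) n)
        (freezeAddSelfFn (sz := sz)) freezeMulTwoFn ∧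
      TransformationCorrectND (fun Is It => ∀ i, Refines (Is i) (It i))
        (fun I n => FreezePre (I ()) n) (fun I n => FreezePre (I ()) n)
        (freezeMulTwoFn (sz := sz)) freezeAddSelfFn := by
  constructor
  · rintro Isrc Itgt Otgt hin ⟨_, n, _, hpt, rfl⟩
    refine ⟨n, FreezePre.of_refines (hin ()) hpt, Or.inr ⟨rfl, ?_⟩⟩
    change Refines (add (defined n) (defined n)) (mul (defined n) (defined 2))
    simp only [add, mul, map₂_defined_defined, defined_refines_defined_iff, mul_two]
  · rintro Isrc Itgt Otgt hin ⟨_, n, _, hpt, rfl⟩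
    refine ⟨n, FreezePre.of_refines (hin ()) hpt, Or.inr ⟨rfl, ?_⟩⟩
    change Refines (mul (defined n) (defined 2)) (add (defined n) (defined n))
    simp only [add, mul, map₂_defined_defined, defined_refines_defined_iff, mul_two]

end FigureOne

end Literature.Computability.LopesEtAl2021
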